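import Mathlib

/-!
# B3 BLOCK-TRACE-MX — the mixed Künneth classes: credit tables, count arithmetic, a `decide`-replay of the M1 N36 row (hsemireg-monad-4 g17)

Companion to memo `Cruxes/BlochSeedDiscOne/B3-BLOCKTRACE-MX-monad4-g17.md` (THEOREM BLOCK-TRACE-MX): the B3 (Buchweitz–Flenner
semiregularity) kernel count of THEOREM BLOCK-TRACE(-SH) (g14 v1.1 ∕ g16) for a letter complex `A → N → C` on `X = (E_i × E_i)^4`,
EXTENDED from the four pure classes `η_f ∈ H²(S_f,𝒪)` to the 24 MIXED Künneth classes `η ∈ H¹(S_f,𝒪) ⊗ H¹(S_g,𝒪) ⊂ H^{0,2}(X)`: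
per block letter `Z` (multiplicity `m`) and class `η`, `β_η = [(m − σ_η)(m − t) − 1]₊` with `σ_η = dim(F + S_η)`, `S_η` = the
column span of the UNFED feeders CREDITED by `η`; the credit of a feeder under a pure tensor `α ⊗ β` is decided factor by factor by
the 1-CREDIT TABLE (memo §2): EQ-live ⇒ credit for every `α ≠ 0`; RAY-live along ray `u` ⇒ credit iff `α ∉ ℓ_u := q_u^* H¹(E_u,𝒪)`
(one line in `H¹(S,𝒪) ≅ ℂ²`; the four rays give four distinct lines); AMPLE ⇒ never; a feeder is `α ⊗ β`-credited iff credited on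
`f` by `α` AND on `g` by `β`.

This file checks ONLY finite tables, list arithmetic and one linear-algebra triviality (no geometry, no sheaf, no design verdict):
* §1 `FType`, `Line`, `cred`, `credPure`, `credPair` — the 1-credit table as Boolean functions and its case lemmas; `credPair_charged`
  (COROLLARY MX-CHARGED: on a factor where `Z` is charged every feeder is EQ or RAY along ONE ray `u`, so under the dead lines
  `(ℓ_{u_f}, ℓ_{u_g})` exactly the feeders EQ with `Z` on BOTH factors stay credited).
* §2 the four conjugate fourth roots of unity `W k = conj(i^k)` as Gaussian integers `ℤ × ℤ`: `lines_distinct` (the lines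
  `ℓ_k = ℂ·(1, W k)` are pairwise distinct: `W l − W k ≠ 0`), the rank-2 classes of memo §2.4: `brot_zero_iff` (the form
  `B_s(κ_k, κ_l) = W l − W s · W k` vanishes iff `l = k + s`: the rotation class `η_s` kills exactly the ray pairs `(k, k+s)`),
  `bref_zero_iff` (reflection classes: `W l − W s · conj(W k) = 0` iff `l = s − k`); and `smul_comp_injective_or_zero` — the
  ALL-OR-NOTHING shape of the cup product on a RAY factor (`∪α = a·J` with `J` injective is injective iff `a ≠ 0`, zero iff `a = 0`).
* §3 the count arithmetic: `cnt m τ τη = [(m − min m τ)(m − min m τη) − 1]₊` (natural subtraction), `cnt_of_le` (silence as soon as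
  `m ≤ τη`), the thresholds `cnt3_pos_iff` ∕ `cnt2_pos_iff` (`τ = 0`: positive iff `τη ≤ m − 1`), `grid_noOrphan` (no orphan feeder:
  the 2×2 grid of a pair gives `4·cnt`, the six pairs `24·cnt`, all 28 Künneth classes `28·cnt`) and the 1840bf64 UP-row digits.
* §4 a typed feeder table and its counts (`Feeder`, `tau`, `tauF`, `tauEta`, `betaPure`, `gridSum`) — the `decide`-replayable form
  of the B3 class column (menu (d) of memo g16 §9) — instantiated on the 32 orphan A-feeders of M1 = a24-dblC3's N36 block at bits
  0011 (semihom-1 §9 export `g29-M1-semihom-hj.json.gz`, class index 191; rows transcribed by `g17/code/blocktrace_mx.py`):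
  `n36_tau`, `n36_tauF` (pure: `τ = 0`, `τ_f = 4` on every factor — the B96 ∕ B154 row), `n36_tauEta_ge` (EVERY mixed choice keeps
  `≥ 18` of the 32 orphan columns credited), `n36_tauEta_best` (`= 18` is attained), hence `n36_mx_silent` (`cnt m 0 18 = 0` for
  `m ≤ 3`): the mixed law is SILENT on M1's N36 blocks, like the pure law, and by a wide margin (`18` against the threshold `2`).
Mathlib only; no `sorry`, no new axioms, no `instance`, no notation, no unsafe options.  Letter designs and program-M ADDRESSES ≠
complexes ≠ sheaves ≠ a SEED; nothing here is proved toward HC ∕ HC_CM ∕ HC_AV ∕ №4 ∕ 26512 ∕ 18881 ∕ H2.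
-/

namespace Summit.HodgeConjecture.HodgeConjecture.Cruxes.BlochSeedDiscOne.BlockTraceMX

/-! ## §1 The 1-credit table -/

/-- Live type of ONE factor of a feeder pair `x_h → Z_h` on `S = E_i × E_i`: `eq` — same box (and bit): `Hom ⊇ 𝒪_S`,
cohomology `(1,2,1)`; `ray u` — null-effective difference along ray `u` (`Hom = q_u^* N`, `deg N = D > 0`), cohomology `(D,D,0)`;
`ample` — ample difference (LINE∕BAND alphabets only), cohomology `(χ,0,0)`.  Dead factors (CROSS, reversed RAY, bit-killed EQ)
do not occur: the pair would not be a feeder. -/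
inductive FType
  | eq
  | ray (u : Fin 4)
  | ample
  deriving DecidableEq, Repr

/-- A line in `H¹(S_h,𝒪) ≅ ℂ²` carrying the factor-`h` component of a pure mixed tensor: a GENERIC line, or the dead line
`ℓ_u = q_u^* H¹(E_u,𝒪)` of ray `u` (memo §2.2: the four `ℓ_u` are pairwise distinct, `lines_distinct` below). -/
inductive Line
  | gen
  | dead (u : Fin 4)
  deriving DecidableEq, Repr

open FType Line

/-- 1-CREDIT TABLE (memo §2.1): is the feeder credited on this factor by a class `α` spanning the line `a`?
EQ: always (`∪α : H⁰(𝒪) → H¹(𝒪)` injective); RAY along `u`: iff `α ∉ ℓ_u`; AMPLE: never (`h¹ = 0`). -/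
def cred : FType → Line → Bool
  | eq, _ => true
  | ample, _ => false
  | ray _, gen => true
  | ray u, dead v => decide (u ≠ v)

/-- PURE credit (THEOREM BLOCK-TRACE(-SH), 2.1′): `∪η_f : H⁰ → H²` of the factor bundle is non-zero iff EQ-live. -/
def credPure : FType → Bool
  | eq => true
  | _ => false

/-- Credit of a feeder under the pure tensor `α ⊗ β ∈ H¹(S_f,𝒪) ⊗ H¹(S_g,𝒪)`: credited on `f` by `α` AND on `g` by `β`. -/
def credPair (tf tg : FType) (a b : Line) : Bool := cred tf a && cred tg b

theorem cred_eq (a : Line) : cred eq a = true := by cases a <;> rfl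
theorem cred_ample (a : Line) : cred ample a = false := by cases a <;> rfl
theorem cred_ray_gen (u : Fin 4) : cred (ray u) gen = true := rfl
theorem cred_ray_dead (u v : Fin 4) : cred (ray u) (dead v) = decide (u ≠ v) := rfl
theorem cred_ray_self (u : Fin 4) : cred (ray u) (dead u) = false := by simp [cred]

/-- A pure class credits exactly the EQ factors; a generic mixed component credits EQ and RAY factors alike. -/
theorem credPure_le_cred (t : FType) (a : Line) : credPure t = true → cred t a = true := by
  cases t <;> cases a <;> simp [credPure, cred]

/-- EQ × EQ feeders are credited by every pure tensor (and by every non-zero class of the component, memo §2.3). -/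
theorem credPair_eq_eq (a b : Line) : credPair eq eq a b = true := by simp [credPair, cred_eq]

/-- COROLLARY MX-CHARGED (memo §2.5), row form: if on factor `f` the feeder is EQ or RAY along the one ray `uf`, and on `g`
EQ or RAY along `ug`, then under the dead lines `(ℓ_{uf}, ℓ_{ug})` it is credited iff it is EQ on BOTH factors. -/
theorem credPair_charged (tf tg : FType) (uf ug : Fin 4)
    (hf : tf = eq ∨ tf = ray uf) (hg : tg = eq ∨ tg = ray ug) :
    credPair tf tg (dead uf) (dead ug) = (decide (tf = eq) && decide (tg = eq)) := by
  rcases hf with rfl | rfl <;> rcases hg with rfl | rfl <;> simp [credPair, cred]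

/-! ## §2 The four dead lines and the rank-2 classes (Gaussian-integer shadow) -/

/-- `W k = conj(i^k) ∈ ℤ[i]` as a pair `(re, im)`: the line `ℓ_k ⊂ H^{0,1}(S)` of the ray `u_k = x + i^k y` is spanned by
`dx̄ + conj(i^k) dȳ`, i.e. by the vector `κ_k = (1, W k)`. -/
def W : Fin 4 → ℤ × ℤ := ![(1, 0), (0, -1), (-1, 0), (0, 1)]

/-- complex conjugation on `ℤ × ℤ`. -/
def gconj (a : ℤ × ℤ) : ℤ × ℤ := (a.1, -a.2)
/-- Gaussian multiplication on `ℤ × ℤ`. -/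
def gmul (a b : ℤ × ℤ) : ℤ × ℤ := (a.1 * b.1 - a.2 * b.2, a.1 * b.2 + a.2 * b.1)
/-- subtraction on `ℤ × ℤ`. -/
def gsub (a b : ℤ × ℤ) : ℤ × ℤ := (a.1 - b.1, a.2 - b.2)

/-- `W k = conj (i^k)`: `W (k+1) = W k · conj i` with `conj i = (0,−1)`, `W 0 = 1`. -/
theorem W_succ : ∀ k : Fin 4, W (k + 1) = gmul (W k) (0, -1) := by decide

/-- The four lines `ℓ_k = ℂ·(1, W k)` are pairwise distinct: `det(κ_k, κ_l) = W l − W k ≠ 0` for `k ≠ l` (memo §2.2). -/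
theorem lines_distinct : ∀ k l : Fin 4, k ≠ l → gsub (W l) (W k) ≠ (0, 0) := by decide

/-- ROTATION CLASSES (memo §2.4): the bilinear form `B_s(κ_k, κ_l) = W l − W s · W k` (the class `η_s = e¹⊗e² − conj(i^s) e²⊗e¹`
in coordinates) vanishes iff `l = k + s`; so `η_s` kills exactly the four RAY×RAY ray pairs `(k, k + s)`. -/
theorem brot_zero_iff : ∀ s k l : Fin 4, gsub (W l) (gmul (W s) (W k)) = (0, 0) ↔ l = k + s := by decide

/-- REFLECTION CLASSES (memo §2.4): `W l − W s · conj(W k) = 0` iff `l = s − k`; the class kills the pairs `(k, s − k)`. -/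
theorem bref_zero_iff : ∀ s k l : Fin 4, gsub (W l) (gmul (W s) (gconj (W k))) = (0, 0) ↔ l = s - k := by decide

/-- A rank-2 form kills at most one `l` per `k` — here checked for the eight special forms: for every `s, k` there is EXACTLY one
`l` with `B = 0` (rotation) resp. one `l` (reflection). -/
theorem brot_unique : ∀ s k : Fin 4,
    ((List.finRange 4).filter (fun l => decide (gsub (W l) (gmul (W s) (W k)) = (0, 0)))).length = 1 ∧
      ((List.finRange 4).filter (fun l => decide (gsub (W l) (gmul (W s) (gconj (W k))) = (0, 0)))).length = 1 := by
  decide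

/-- ALL-OR-NOTHING (memo §2.1, the shape of `∪α` on a RAY factor: `∪α = a · J` with `J : H⁰(E_u,N) ≅ H¹(B_u,𝒪) ⊗ H⁰(E_u,N)`
injective, `a` = the `β_B`-coordinate of `α`): a scalar multiple of an injective linear map is injective iff the scalar is
non-zero, and is zero otherwise. -/
theorem smul_comp_injective_or_zero {K V W' : Type*} [Field K] [AddCommGroup V] [Module K V] [AddCommGroup W'] [Module K W']
    (J : V →ₗ[K] W') (hJ : Function.Injective J) (a : K) :
    (a = 0 → a • J = 0) ∧ (a ≠ 0 → Function.Injective (a • J)) := by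
  refine ⟨fun h => by simp [h], fun ha => ?_⟩
  intro v w hvw
  have : a • J v = a • J w := by simpa using hvw
  exact hJ (smul_right_injective W' ha this)

/-! ## §3 Count arithmetic -/

/-- The surrogate count of one class: `[(m − min m τ)(m − min m τη) − 1]₊` (natural subtraction truncates at 0). -/
def cnt (m τ τη : ℕ) : ℕ := (m - min m τ) * (m - min m τη) - 1

theorem cnt_of_le {m τ τη : ℕ} (h : m ≤ τη) : cnt m τ τη = 0 := by
  simp [cnt, Nat.min_eq_left h]

theorem cnt_of_le' {m τ τη : ℕ} (h : m ≤ τ) : cnt m τ τη = 0 := by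
  simp [cnt, Nat.min_eq_left h]

/-- `τ = 0`, `m = 3` (M1's N36 blocks of record): the class counts iff at most `2` orphan columns stay credited. -/
theorem cnt3_pos_iff (τη : ℕ) : 1 ≤ cnt 3 0 τη ↔ τη ≤ 2 := by
  unfold cnt
  rcases Nat.lt_or_ge τη 3 with h | h
  · interval_cases τη <;> simp
  · simp [Nat.min_eq_left h]; omega

/-- `τ = 0`, `m = 2` (the twelve `m = 2` N36 blocks): the class counts iff at most `1` orphan column stays credited. -/
theorem cnt2_pos_iff (τη : ℕ) : 1 ≤ cnt 2 0 τη ↔ τη ≤ 1 := by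
  unfold cnt
  rcases Nat.lt_or_ge τη 2 with h | h
  · interval_cases τη <;> simp
  · simp [Nat.min_eq_left h]; omega

/-- No orphan feeder (every feeder fed or visible): every class of a pair has `τη = τ`, the 2×2 grid gives `4·cnt`, the six
pairs `24·cnt`, and with the four pure classes all `28 = h^{0,2}(X)` Künneth classes give `28·cnt` (memo §1.5 (c)). -/
theorem grid_noOrphan (m τ : ℕ) :
    4 * cnt m τ τ + 6 * (4 * cnt m τ τ) = 28 * cnt m τ τ := by ring

/-- 1840bf64 (BAND-4 two-term UP reading, g15 x2 row): block `m = 14166`, `τ = τ_f = τη = 8064` (two fed∕visible feeders, no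
orphan): per class `6102² − 1 = 37 234 403`; pure `148 937 612`; mixed `893 625 672`; total `1 042 563 284` (instrument
`mx-1840bf64.out`). -/
theorem row_1840bf64 :
    cnt 14166 8064 8064 = 37234403 ∧ 4 * cnt 14166 8064 8064 = 148937612 ∧
      24 * cnt 14166 8064 8064 = 893625672 ∧ 28 * cnt 14166 8064 8064 = 1042563284 := by
  norm_num [cnt]

/-! ## §4 Typed feeder tables (menu (d): the B3 class column as a `decide`-replayable predicate) -/

/-- One feeder `x` of the block `Z`: `cols = m_x · h⁰(x → Z)` columns, `fv` = fed-able or H²-visible (its columns enter `T`,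
surrogate `τ`), and its live type on each factor. -/
structure Feeder where
  cols : ℕ
  fv : Bool
  typ : Fin 4 → FType
  deriving DecidableEq

/-- `τ` = columns of fed-or-visible feeders (`t ≤ min m τ`). -/
def tau (L : List Feeder) : ℕ := (L.filter (·.fv)).foldr (fun x s => x.cols + s) 0

/-- the orphan (un-fed-able, invisible) feeders. -/
def orphans (L : List Feeder) : List Feeder := L.filter (fun x => !x.fv)

/-- pure surrogate `τ_f = τ + (orphan columns EQ-live on f)` (`σ_f ≤ min m τ_f`). -/
def tauF (L : List Feeder) (f : Fin 4) : ℕ :=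
  tau L + ((orphans L).filter (fun x => credPure (x.typ f))).foldr (fun x s => x.cols + s) 0

/-- mixed surrogate `τ_η = τ + (orphan columns credited on f by the line a AND on g by the line b)` (`σ_η ≤ min m τ_η`). -/
def tauEta (L : List Feeder) (f g : Fin 4) (a b : Line) : ℕ :=
  tau L + ((orphans L).filter (fun x => credPair (x.typ f) (x.typ g) a b)).foldr (fun x s => x.cols + s) 0

/-- pure count `β_pure = Σ_f cnt m τ τ_f` (THEOREM BLOCK-TRACE surrogate, = g15 `blocktrace2.py` ∕ check-class B154). -/
def betaPure (m : ℕ) (L : List Feeder) : ℕ :=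
  cnt m (tau L) (tauF L 0) + cnt m (tau L) (tauF L 1) + cnt m (tau L) (tauF L 2) + cnt m (tau L) (tauF L 3)

/-- the 2×2 GRID count of a pair `(f,g)` for line choices `a₁ ≠ a₂`, `b₁ ≠ b₂` (four independent pure tensors, memo §1.4). -/
def gridSum (m : ℕ) (L : List Feeder) (f g : Fin 4) (a₁ a₂ b₁ b₂ : Line) : ℕ :=
  cnt m (tau L) (tauEta L f g a₁ b₁) + cnt m (tau L) (tauEta L f g a₁ b₂) +
    cnt m (tau L) (tauEta L f g a₂ b₁) + cnt m (tau L) (tauEta L f g a₂ b₂)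

/-- abbreviation for an orphan single-column row. -/
def orow (t0 t1 t2 t3 : FType) : Feeder := ⟨1, false, ![t0, t1, t2, t3]⟩

/-- The 32 orphan A-feeders (16 P70 + 16 P72, one column each, none fed-able, none visible) of the N36 block at bits 0011
(multiplicity 3) of M1 = a24-dblC3, semihom-1 §9 export class index 191; `ray k` = the feeder's ray `u = k` on that factor
(the block is the apex there), `eq` = apex with the block's bit (instrument `g17/data/out/N36-0011-M1-orphans.json`). -/
def n36 : List Feeder :=
  [orow (ray 2) (ray 2) (ray 2) (ray 3), orow (ray 2) (ray 2) (ray 3) (ray 2), orow (ray 2) (ray 3) (ray 2) (ray 2),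
   orow (ray 3) (ray 3) (ray 3) (ray 0), orow (ray 3) (ray 3) (ray 0) (ray 3), orow (ray 3) (ray 0) (ray 3) (ray 3),
   orow (ray 1) (ray 1) (ray 1) (ray 2), orow (ray 1) (ray 1) (ray 2) (ray 1), orow (ray 1) (ray 2) (ray 1) (ray 1),
   orow (ray 0) (ray 0) (ray 0) (ray 1), orow (ray 0) (ray 0) (ray 1) (ray 0), orow (ray 0) (ray 1) (ray 0) (ray 0),
   orow (ray 2) (ray 1) (ray 1) (ray 1), orow (ray 3) (ray 2) (ray 2) (ray 2), orow (ray 1) (ray 0) (ray 0) (ray 0),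
   orow (ray 0) (ray 3) (ray 3) (ray 3),
   orow (ray 2) (ray 2) (ray 3) eq, orow (ray 2) (ray 3) eq (ray 2), orow (ray 2) eq (ray 1) (ray 1),
   orow (ray 3) (ray 3) (ray 0) eq, orow (ray 3) (ray 0) eq (ray 3), orow (ray 3) eq (ray 2) (ray 2),
   orow (ray 1) (ray 2) eq (ray 1), orow (ray 1) (ray 1) (ray 2) eq, orow (ray 1) eq (ray 0) (ray 0),
   orow (ray 0) (ray 1) eq (ray 0), orow (ray 0) (ray 0) (ray 1) eq, orow (ray 0) eq (ray 3) (ray 3),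
   orow eq (ray 2) (ray 2) (ray 3), orow eq (ray 3) (ray 3) (ray 0), orow eq (ray 1) (ray 1) (ray 2), orow eq (ray 0) (ray 0) (ray 1)]

theorem n36_length : n36.length = 32 := by decide

/-- pure row (check-static B96 ∕ check-class B154 ∕ g16 `n36_level_silent`): `τ = 0`, `τ_f = 4` on every factor. -/
theorem n36_tau : tau n36 = 0 := by decide
theorem n36_tauF : ∀ f : Fin 4, tauF n36 f = 4 := by decide
theorem n36_betaPure : betaPure 3 n36 = 0 ∧ betaPure 2 n36 = 0 := by decide

/-- all five line choices on a factor (generic, or one of the four dead lines). -/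
def lines : List Line := [gen, dead 0, dead 1, dead 2, dead 3]

/-- MIXED row: for EVERY pair of factors and EVERY choice of lines at least `18` of the 32 orphan columns stay credited … -/
theorem n36_tauEta_ge : ∀ f g : Fin 4, f ≠ g → ∀ a ∈ lines, ∀ b ∈ lines, 18 ≤ tauEta n36 f g a b := by decide

/-- … and `18` is attained (e.g. factors `(0,1)`, `α ∈ ℓ_0`, `β ∈ ℓ_2`). -/
theorem n36_tauEta_best : tauEta n36 0 1 (dead 0) (dead 2) = 18 := by decide

/-- the generic mixed class credits all 32 orphans; a dead line on ONE factor removes 7 (4 P70 + 3 P72). -/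
theorem n36_tauEta_generic : tauEta n36 0 1 gen gen = 32 ∧ tauEta n36 0 1 (dead 0) gen = 25 := by decide

/-- Hence every mixed class is SILENT on the N36 blocks (`m = 3` and `m = 2`): `cnt m 0 τη = 0` whenever `τη ≥ m`,
in particular at the best value `18`; the thresholds are `τη ≤ 2` resp. `≤ 1` (`cnt3_pos_iff`, `cnt2_pos_iff`). -/
theorem n36_mx_silent : cnt 3 0 18 = 0 ∧ cnt 2 0 18 = 0 ∧ gridSum 3 n36 0 1 (dead 0) (dead 1) (dead 2) (dead 3) = 0 := by decide

/-- the margin, for the record: under the pure law one factor with `τ_f = 2` would count `2` (g16 `n36_margin_one`); under the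
mixed law a pair with `τη = 2` would count `2` as well, `τη = 0` (no credited orphan) `8 = m² − 1`. -/
theorem n36_mx_hypothetical : cnt 3 0 2 = 2 ∧ cnt 3 0 0 = 8 := by decide

end Summit.HodgeConjecture.HodgeConjecture.Cruxes.BlochSeedDiscOne.BlockTraceMX
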